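import Summits.QuantumFields.BalabanUV.T4Continuum.Spine.NE1p.DressedRoot
import Summits.QuantumFields.BalabanUV.T4Continuum.Support.T4TrajectoryDensityAssembly
import Summits.QuantumFields.BalabanUV.T4Continuum.Support.T4TrajectoryDensityFreshMargin

/-!
# T⁴ programme, spine estimate NE1′ (node O3b/H2) — leaf F-5 ((w3)⁺ WINDOW NESTING): THE WINDOW SCHEDULE LEMMA

Cell `pub-balaban`, sub-cell `t4`, BINDER-OWNERS row NE1′, formalisation swarm `b2b-balaban-t4-ne1p-formalise-*` (trigger
`t4/T4-NE1p-TRIGGER.json`, t4-ref2 pass 63 ∕ scope_update_64), crew row **S1** of the owner's seat plan (skeleton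
`t4/skeletons/NE1p-t4-ne1p-p1.md` v1.1 §6; claim table `t4/formal/NE1p/LEAVES.md`), seat `b2b-balaban-t4-ne1p-formalise-leaf-04`;
tree target `Summits/QuantumFields/BalabanUV/T4Continuum/Spine/NE1p/`; ADDITIVE — imports `Spine/NE1p/DressedRoot`,
`Support/T4TrajectoryDensityAssembly`, `Support/T4TrajectoryDensityFreshMargin` ONLY, modifies nothing.

WHAT THIS FILE DOES (owner §6, row S1, verbatim task: «from a bond-ball radius schedule ρ_k (decreasing, gaps ≥ w + ϱ₁ + s)
produce ALL nesting margins hN1∕hN2∕hdiam∕hθ∕hN1x∕hN2cx∕hmargin of END-F + Assembly at once (`bondBall_latMove_add_mem`,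
`bondBall_complexMargin` by name)»).  In the lineage's one-frame lattice model (`T4TrajectoryModulus` §K: backgrounds and
fluctuations are `R`-valued bond fields, windows are bond-wise sup-norm balls `bondBall d ρ`, background and fluctuation compose
ADDITIVELY) the geometric binders of END-F `DressedRoot.transportLeaf_of_centredExponent` and of the assembled `hP`
(`T4TrajectoryDensityDressed.pertSlice_under_history`) are, per met step `k`, located WINDOW CONDITIONS between the radii of
consecutive steps.  This file packages those radii as ONE piece of data — a **`WindowSchedule r w`** (§1): window radii `ρw k`,
fluctuation radii `σ k`, complex chart radii `ϱc k`, margin radii `ϱ₁ k`, with the inequalities `0 < σ k`, `2σ k ≤ w`,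
`0 < ϱc k < ϱ₁ k ≤ r`, `ϱ₁ (k+1) ≤ ϱc k` and THE GAP `ρw (k+1) + w + ϱ₁ k + σ k ≤ ρw k` — and proves (§2) that the schedule
DISCHARGES AT ONCE, in the binders' verbatim shapes with `𝒦 b k′ k := bondBall d (ρw k)`, `D b k := bondBall d (σ k)`,
`θ b k := 2σ k`, `ϱ b k′ k := ϱc k`, `ϱ₁ b k := ϱ₁ k`, `rs f k″ k := sliceR W k″ k` (`= r` at birth, `= ϱc (k−1)` after):
END-F's `hD`, `hϱ`, `hN1`, `hN2`, `hdiam`, `hθ` and the Assembly's `hrs_birth`, `hrs_step`, `hrs_dec`, `hmargin`, `hN1x`, `hN2cx`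
(given the reference fluctuation `z₁ b k ∈ D b k`).  §3 composes: **`transportLeaf_of_schedule`** = END-F with the six geometric
binders gone (conclusion VERBATIM the field type of `BookingLeaves.htr`), and **`pertSlice_under_history_of_schedule`** = the
assembled `hP` with its seven geometric ∕ radius binders gone.  §4 is non-vacuity and the located cost: `WindowSchedule.geometric`
inhabits the schedule for every `r, w > 0`; `WindowSchedule.window_budget` — EVERY MET STEP CONSUMES AT LEAST `w` OF WINDOW
RADIUS (`ρw K + K·w ≤ ρw 0`), the kernel form of the owner's R-slack answer (OWNER-ANSWERS-g23 §F: with one chart window `w` the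
slack needed grows linearly in the number of met steps of a family — a CAP on met steps per family or step-dependent windows is
where (w3)⁺ meets the wall; recorded, not resolved here).

HONEST FRAMING.  Rung (B)+1 bookkeeping on ONE finite four-torus of fixed physical size — NOT infinite volume, NOT a mass gap,
NOT the Clay problem, NOT summit progress.  NE1′ is NOT PRINTED and NOT PROVED; this file reads «END-F's geometry ⇐ a window
schedule», never «NE1′ proved».  [folklore] lattice geometry (triangle inequality) and kernel glue, 0 sorry, 0 citations used as
facts; the schedule is a BINDER — no radius of Bałaban's windows ([Balaban1989LargeFieldI] p. 190 «the old action … has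
effectively a larger analyticity domain with respect to the new field», (1.27) p. 187: printed TYPE only) is asserted, and whether
a schedule fits inside the printed windows along a family's history is (w3)⁺'s content, untouched.  The estimate binders (w1)
`hsl`, H2 `hFn`, (w2-act) `hB`∕`hE`, `hP` (resp. its assembled data), (w4) `hdom`, (I4′) `hdefw`∕`hrate`∕`hpairx`, attainment,
invariance, measurability stay displayed.  Spine PROVED 0∕9 unchanged.  HONEST DEPENDENCY: continuum YM on T⁴ ⇐ BetaPertH ∧
nine spine estimates (0/9 proved); BetaPertH ⇐ (D1) ∧ (D4) ∧ CAP+tail; G-an2-4 gates asym, D1 and NE2/3/4.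
-/

noncomputable section

namespace Summit.QuantumFields.BalabanUV.T4Continuum.NE1p.DressedWindowSchedule

open MeasureTheory Set Metric Finset
open scoped BigOperators
open Literature.MathematicalPhysics.QuantumFieldTheory.Balaban1983to89
open Literature.MathematicalPhysics.QuantumFieldTheory.Balaban1983to89.T4TermFormat
open Literature.MathematicalPhysics.QuantumFieldTheory.Balaban1983to89.T4GatedBooking
open Literature.MathematicalPhysics.QuantumFieldTheory.Balaban1983to89.T4TrajectoryComparison
open Literature.MathematicalPhysics.QuantumFieldTheory.Balaban1983to89.T4TrajectoryModulus
open T4BirthChartTransport (GaugeInvariant BirthSlice RelGauge)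
open T4BlockTransport (Fld NDir latMove latN)
open T4TrajectoryDensity
open Summit.QuantumFields.BalabanUV.T4Continuum.T4TrajectoryDensityDressed

/-! ## §1 The window schedule: data and located inequalities -/

/-- **A WINDOW SCHEDULE** for birth radius `r` and chart window `w` [data + hypothesis shapes]: per step `k`, the window radius
`ρw k` (the regular-base ∕ analyticity window of the CURRENT step, a bond ball), the fluctuation radius `σ k` (the small-field
size of the step-`k` fluctuation: `D k = bondBall d (σ k)`, diameter `2σ k ≤ w`), the complex chart radius `ϱc k` granted to a
carried term at step `k` (its slice radius from step `k+1` on) and the margin radius `ϱ₁ k` of the complex chart motions, with: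
positivity, `2σ k ≤ w`, the radius ordering `ϱc k < ϱ₁ k ≤ r`, `ϱ₁ (k+1) ≤ ϱc k` (the margin of the next step fits in the
radius granted at this step), and THE GAP `ρw (k+1) + w + ϱ₁ k + σ k ≤ ρw k` (window of step `k+1`, fattened by a chart motion
of bound `w`, its complex margin and a fluctuation, lies in the window of step `k`).  Numbers and inequalities only — a BINDER of
the instantiation; NOT asserted for Bałaban's windows. [folklore] -/
structure WindowSchedule (r w : ℝ) where
  /-- window radius at step `k` -/
  ρw : ℕ → ℝ
  /-- fluctuation radius at step `k` -/
  σ : ℕ → ℝ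
  /-- complex chart radius granted at step `k` -/
  ϱc : ℕ → ℝ
  /-- margin radius of the complex chart motions at step `k` -/
  ϱ₁ : ℕ → ℝ
  hσ : ∀ k, 0 < σ k
  hσw : ∀ k, 2 * σ k ≤ w
  hϱc : ∀ k, 0 < ϱc k
  hϱc₁ : ∀ k, ϱc k < ϱ₁ k
  hϱ₁r : ∀ k, ϱ₁ k ≤ r
  hϱ₁c : ∀ k, ϱ₁ (k + 1) ≤ ϱc k
  /-- THE GAP between consecutive windows -/
  hgap : ∀ k, ρw (k + 1) + w + ϱ₁ k + σ k ≤ ρw k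

namespace WindowSchedule

variable {r w : ℝ} (W : WindowSchedule r w)

/-- [arith] [folklore] Fluctuation radii are nonnegative. -/
theorem σ_nonneg (k : ℕ) : 0 ≤ W.σ k := (W.hσ k).le
/-- [arith] [folklore] The chart window is positive (it dominates a positive diameter). -/
theorem w_pos (W : WindowSchedule r w) : 0 < w := lt_of_lt_of_le (by linarith [W.hσ 0]) (W.hσw 0)
/-- [arith] [folklore] Margin radii are positive. -/
theorem ϱ₁_pos (k : ℕ) : 0 < W.ϱ₁ k := (W.hϱc k).trans (W.hϱc₁ k)
/-- [arith] [folklore] The chart radii decrease strictly. -/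
theorem ϱc_lt_ϱc (k : ℕ) : W.ϱc (k + 1) < W.ϱc k := (W.hϱc₁ (k + 1)).trans_le (W.hϱ₁c k)
/-- [arith] [folklore] Chart radii are below the birth radius. -/
theorem ϱc_lt_r (k : ℕ) : W.ϱc k < r := (W.hϱc₁ k).trans_le (W.hϱ₁r k)

/-- [arith] [folklore] The (N1) gap `ρw (k+1) + σ k ≤ ρw k`. -/
theorem gap_N1 (k : ℕ) : W.ρw (k + 1) + W.σ k ≤ W.ρw k := by
  linarith [W.hgap k, W.w_pos, W.ϱ₁_pos k]

/-- [arith] [folklore] The (N2) gap `ρw (k+1) + w + σ k ≤ ρw k`. -/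
theorem gap_N2 (k : ℕ) : W.ρw (k + 1) + w + W.σ k ≤ W.ρw k := by
  linarith [W.hgap k, W.ϱ₁_pos k]

/-- [arith] [folklore] Windows shrink strictly, by more than `w` per step. -/
theorem ρw_add_w_lt (k : ℕ) : W.ρw (k + 1) + w < W.ρw k := by
  linarith [W.hgap k, W.ϱ₁_pos k, W.hσ k]

/-- **THE SLICE RADIUS OF A GENERATION** born at step `k″`, at step `k` [data]: `r` at birth (`k ≤ k″`), the chart radius
`ϱc (k−1)` granted at the previous step afterwards. [folklore] -/
def sliceR (W : WindowSchedule r w) (k'' k : ℕ) : ℝ := if k'' < k then W.ϱc (k - 1) else r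

/-- [folklore] At birth the slice radius is `r`. -/
@[simp] theorem sliceR_birth (k'' : ℕ) : W.sliceR k'' k'' = r := by simp [sliceR]

/-- [folklore] After step `k ≥ k″` the slice radius is the chart radius granted at `k`. -/
theorem sliceR_step {k'' k : ℕ} (h : k'' ≤ k) : W.sliceR k'' (k + 1) = W.ϱc k := by
  simp [sliceR, Nat.lt_succ_of_le h]

/-- [folklore] The chart radius granted at step `k` is STRICTLY below the current slice radius (for any birth step). -/
theorem ϱc_lt_sliceR (k'' k : ℕ) : W.ϱc k < W.sliceR k'' k := by
  unfold sliceR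
  split_ifs with h
  · obtain ⟨j, rfl⟩ := Nat.exists_eq_add_of_lt h
    simpa [Nat.add_assoc] using W.ϱc_lt_ϱc (k'' + j)
  · exact W.ϱc_lt_r k

/-- [folklore] The margin radius of step `k` is below every current slice radius (for any birth step). -/
theorem ϱ₁_le_sliceR (k'' k : ℕ) : W.ϱ₁ k ≤ W.sliceR k'' k := by
  unfold sliceR
  split_ifs with h
  · obtain ⟨j, rfl⟩ := Nat.exists_eq_add_of_lt h
    simpa [Nat.add_assoc] using W.hϱ₁c (k'' + j)
  · exact W.hϱ₁r k

/-- **THE LOCATED COST OF A SCHEDULE (R-slack)** [arith]: every met step consumes MORE than `w` of window radius, so after `K`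
steps `ρw K + K·w ≤ ρw 0` — with ONE chart window `w > 0` the birth window must exceed `K·w`: a K-free window budget needs a
cap on the met steps of a family or step-dependent chart windows (owner's answer §F: R-slack = Q-fam-cap ∕ Q-scale in window
currency).  Recorded as arithmetic; nothing resolved. [folklore] -/
theorem window_budget : ∀ K : ℕ, W.ρw K + K * w ≤ W.ρw 0 := by
  intro K
  induction K with
  | zero => simp
  | succ K ih =>
    have h := W.ρw_add_w_lt K
    push_cast
    linarith

end WindowSchedule

/-! ## §2 The schedule discharges the geometric binders, in their verbatim shapes -/

section Binders

variable {r w : ℝ} (W : WindowSchedule r w)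
variable {B : T4TermFormat.Booking} {R : Type*} [NormedRing R] {d : ℕ}

/-- **`hD`** of END-F [folklore]: fluctuation domains are inhabited (by `0`). -/
theorem hD_of_schedule : ∀ (_b : B.Birth) (k : ℕ), ((bondBall d (W.σ k) : Set (Fld d R))).Nonempty :=
  fun _ k => ⟨0, fun x ν => by simpa using W.σ_nonneg k⟩

/-- **`hϱ`** of END-F [folklore]: chart radii are positive. -/
theorem hϱ_of_schedule : ∀ (_b : B.Birth) (_k' k : ℕ), 0 < W.ϱc k := fun _ _ k => W.hϱc k

/-- **`hN1`** of END-F ∕ the Assembly [folklore] (NESTING (N1)): the step-`(k+1)` window translated by a step-`k` fluctuation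
lies in the step-`k` window — `bondBall_add_mem` on the gap. -/
theorem hN1_of_schedule :
    ∀ (b : B.Birth) (k' k : ℕ), B.birthScale b ≤ k' → k' ≤ k → k + 1 ≤ B.K →
      ∀ z ∈ (bondBall d (W.σ k) : Set (Fld d R)), ∀ U ∈ (bondBall d (W.ρw (k + 1)) : Set (Fld d R)),
        U + z ∈ (bondBall d (W.ρw k) : Set (Fld d R)) :=
  fun _ _ k _ _ _ => bondBall_add_mem (W.gap_N1 k)

/-- **`hdiam`** of END-F [folklore] (DIAM): the fluctuation domain of step `k` has bond-wise diameter `≤ 2σ k` — `bondBall_diam`. -/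
theorem hdiam_of_schedule :
    ∀ (_b : B.Birth) (k : ℕ), ∀ z ∈ (bondBall d (W.σ k) : Set (Fld d R)), ∀ z' ∈ (bondBall d (W.σ k) : Set (Fld d R)),
      ∀ x ν, ‖z x ν - z' x ν‖ ≤ 2 * W.σ k :=
  fun _ _ => bondBall_diam

/-- **`hθ`** of END-F [folklore]: the diameter `2σ k` is positive and within the chart window. -/
theorem hθ_of_schedule : ∀ (_b : B.Birth) (k : ℕ), 0 < 2 * W.σ k ∧ 2 * W.σ k ≤ w :=
  fun _ k => ⟨by linarith [W.hσ k], W.hσw k⟩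

/-- **`hN1x`** of the Assembly [folklore] (CROSS-FAMILY (N1)): the step-`(k+1)` window of the transported family translated by a
step-`k` fluctuation lies in the step-`k` window of EVERY live generation of its met component — with a step-indexed schedule the
windows of all families at step `k` coincide, so this is (N1) again. -/
theorem hN1x_of_schedule (S : ℕ → B.Birth → Finset (B.Birth × ℕ)) :
    ∀ (b : B.Birth) (k' k : ℕ), B.birthScale b ≤ k' → k' ≤ k →
      ∀ p ∈ S k b, ∀ z ∈ (bondBall d (W.σ k) : Set (Fld d R)), ∀ U ∈ (bondBall d (W.ρw (k + 1)) : Set (Fld d R)),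
        U + z ∈ (bondBall d (W.ρw k) : Set (Fld d R)) :=
  fun _ _ k _ _ _ _ => bondBall_add_mem (W.gap_N1 k)

/-- **`hrs_birth`** of the Assembly [folklore]: slice radius `r` at birth. -/
theorem hrs_birth_of_schedule : ∀ (_f : B.Birth) (k'' : ℕ), W.sliceR k'' k'' = r := fun _ k'' => W.sliceR_birth k''

/-- **`hrs_step`** of the Assembly [folklore]: after step `k` the slice radius is the chart radius granted at `k`. -/
theorem hrs_step_of_schedule :
    ∀ (f : B.Birth) (k'' k : ℕ), B.birthScale f ≤ k'' → k'' ≤ k → W.sliceR k'' (k + 1) = W.ϱc k :=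
  fun _ _ _ _ h => W.sliceR_step h

/-- **`hrs_dec`** of the Assembly [folklore]: the chart radius granted at `k` is strictly below the current slice radius. -/
theorem hrs_dec_of_schedule :
    ∀ (f : B.Birth) (k'' k : ℕ), B.birthScale f ≤ k'' → k'' ≤ k → W.ϱc k < W.sliceR k'' k :=
  fun _ k'' k _ _ => W.ϱc_lt_sliceR k'' k

/-- **`hmargin`** of the Assembly [folklore]: radii ordered — chart radius `<` margin radius, margin radius positive and below the
current slice radius of every live generation of the met component (for a step-indexed schedule: of ANY generation). -/
theorem hmargin_of_schedule (S : ℕ → B.Birth → Finset (B.Birth × ℕ)) :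
    ∀ (b : B.Birth) (k' k : ℕ), B.birthScale b ≤ k' → k' ≤ k →
      W.ϱc k < W.ϱ₁ k ∧ 0 < W.ϱ₁ k ∧ ∀ p ∈ S k b, W.ϱ₁ k ≤ W.sliceR p.2 k :=
  fun _ _ k _ _ => ⟨W.hϱc₁ k, W.ϱ₁_pos k, fun p _ => W.ϱ₁_le_sliceR p.2 k⟩

variable [NormedAlgebra ℂ R]

/-- **`hN2`** of END-F [folklore] (NESTING (N2), window-guarded): the step-`(k+1)` window moved by a chart motion of bound `≤ w`
and translated by a step-`k` fluctuation lies in the step-`k` window — `bondBall_latMove_add_mem` on the gap. -/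
theorem hN2_of_schedule :
    ∀ (b : B.Birth) (k' k : ℕ), B.birthScale b ≤ k' → k' ≤ k → k + 1 ≤ B.K →
      ∀ U₀ ∈ (bondBall d (W.ρw (k + 1)) : Set (Fld d R)), ∀ p : NDir d R, latN p ≤ w →
        ∀ z' ∈ (bondBall d (W.σ k) : Set (Fld d R)), latMove U₀ p 1 + z' ∈ (bondBall d (W.ρw k) : Set (Fld d R)) :=
  fun _ _ k _ _ _ => bondBall_latMove_add_mem (W.gap_N2 k)

/-- **`hN2cx`** of the Assembly [folklore] (CROSS-FAMILY COMPLEX MARGIN (N2ᶜ)): the step-`(k+1)` window moved along a declared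
direction of bound `≤ w` over the WHOLE TUBE of radius `ϱ₁ k / latN pd` and translated by the reference fluctuation
`z₁ b k ∈ D b k` lies in the step-`k` window of every live generation — `bondBall_complexMargin` on the full gap
`ρw (k+1) + w + ϱ₁ k + σ k ≤ ρw k`. -/
theorem hN2cx_of_schedule (S : ℕ → B.Birth → Finset (B.Birth × ℕ)) {z₁ : B.Birth → ℕ → Fld d R}
    (hz₁ : ∀ b k, z₁ b k ∈ (bondBall d (W.σ k) : Set (Fld d R))) :
    ∀ (b : B.Birth) (k' k : ℕ), B.birthScale b ≤ k' → k' ≤ k →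
      ∀ p ∈ S k b, ∀ U₀ ∈ (bondBall d (W.ρw (k + 1)) : Set (Fld d R)), ∀ pd : NDir d R, 0 < latN pd → latN pd ≤ w →
        ∀ t ∈ tube (W.ϱ₁ k / latN pd), latMove U₀ pd t + z₁ b k ∈ (bondBall d (W.ρw k) : Set (Fld d R)) :=
  fun b _ k _ _ _ _ U₀ hU₀ pd hpd hpdw t ht =>
    bondBall_complexMargin (W.ϱ₁_pos k).le (W.hgap k) U₀ hU₀ pd hpd hpdw t ht (z₁ b k) (hz₁ b k)

end Binders

/-! ## §3 Composition: END-F and the assembled `hP` with their geometry discharged by the schedule -/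

section Composition

variable {r w : ℝ} (W : WindowSchedule r w)
variable {B : T4TermFormat.Booking} {T : Trajectory B}
variable {R : Type*} [NormedRing R] [NormedAlgebra ℂ R] [MeasurableSpace R] {d : ℕ}
  {F : Type*} [NormedAddCommGroup F] [NormedSpace ℂ F] [CompleteSpace F]

/-- **END-F UNDER A WINDOW SCHEDULE** [bookkeeping]: `DressedRoot.transportLeaf_of_centredExponent` with windows
`𝒦 b k′ k := bondBall d (ρw k)`, fluctuation domains `D b k := bondBall d (σ k)`, diameters `θ b k := 2σ k` and chart radii
`ϱ b k′ k := ϱc k` read off the schedule — its geometric binders `hD`, `hϱ`, `hN1`, `hN2`, `hdiam`, `hθ` are DISCHARGED (§2); the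
domination (w4) reads `e³·(1 + 8σ k ∕ ϱc k) ≤ α k`.  Displayed: (w1) `hsl`, H2 `hFn`∕`h𝒢`, (w2-act) `hB`∕`hE`, `hP`, `hDμ`, (w4)
`hdom`, invariance, (I4′) `hdefw`∕`hrate`, attainment `hlin`.  Conclusion: VERBATIM the field type of `BookingLeaves.htr` with
`C = 4c_δ/r`, `ρ i = ψ·α i`. [folklore] -/
theorem transportLeaf_of_schedule {Fn : B.Birth → ℕ → ℕ → Fld d R → F}
    {rel : B.Birth → ℕ → ℕ → Fld d R → Fld d R → Prop}
    {ref : B.Birth → ℕ → Fld d R → Fld d R} {base : B.Birth → ℕ → Fld d R → ℝ}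
    {𝒜 𝒬 : B.Birth → ℕ → Fld d R → Fld d R → ℂ} {q : B.Birth → ℕ → Fld d R → ℂ}
    {μ : B.Birth → ℕ → Measure (Fld d R)} {z₀ : B.Birth → ℕ → Fld d R}
    {defect : B.Birth → ℕ → ℕ → ℝ} {cδ ψ m : ℝ} {s : B.Birth → ℕ → ℝ} {α : ℕ → ℝ}
    {S : ℕ → B.Birth → Finset B.Birth}
    (hα : ∀ i, 0 ≤ α i) (hr : 0 < r)
    (hsl : ∀ (b : B.Birth) (k' : ℕ), B.birthScale b ≤ k' → k' ≤ B.K →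
      RanBelow (budgetGate T s m S (4 * cδ / r) (fun i => ψ * α i)) k' →
      BirthSlice (Fn b k' k') latMove latN (bondBall d (W.ρw k') : Set (Fld d R)) w r (T.gen b k'))
    (hFn : ∀ (b : B.Birth) (k' k : ℕ), B.birthScale b ≤ k' → k' ≤ k → k + 1 ≤ B.K →
      RanBelow (budgetGate T s m S (4 * cδ / r) (fun i => ψ * α i)) (k + 1) →
      ∀ U, Fn b k' (k + 1) U =
        wOp (expWeight (base b k) (𝒜 b k + 𝒬 b k)) (μ b k) (z₀ b k) U (fun z => Fn b k' k (U + z)))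
    (h𝒢 : ∀ (b : B.Birth) (k' k : ℕ), B.birthScale b ≤ k' → k' ≤ k → k + 1 ≤ B.K →
      RanBelow (budgetGate T s m S (4 * cδ / r) (fun i => ψ * α i)) (k + 1) →
      ∀ U, (fun z => Fn b k' k (U + z)) ∈ BddClass F (μ b k))
    (hB : ∀ (b : B.Birth) (k' k : ℕ), B.birthScale b ≤ k' → k' ≤ k → k + 1 ≤ B.K →
      RanBelow (budgetGate T s m S (4 * cδ / r) (fun i => ψ * α i)) (k + 1) →
      RealBaseAt (ref b k) (base b k) (𝒜 b k) (μ b k) (bondBall d (W.ρw (k + 1)) : Set (Fld d R)))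
    (hE : ∀ (b : B.Birth) (k' k : ℕ), B.birthScale b ≤ k' → k' ≤ k → k + 1 ≤ B.K →
      RanBelow (budgetGate T s m S (4 * cδ / r) (fun i => ψ * α i)) (k + 1) →
      ExponentSliceAt (ref b k) (𝒜 b k) (μ b k) latMove latN (bondBall d (W.ρw (k + 1)) : Set (Fld d R)) w (W.ϱc k)
        (s b k))
    (hP : ∀ (b : B.Birth) (k' k : ℕ), B.birthScale b ≤ k' → k' ≤ k → k + 1 ≤ B.K →
      RanBelow (budgetGate T s m S (4 * cδ / r) (fun i => ψ * α i)) (k + 1) →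
      PertSlice (fun U z => 𝒬 b k U z - q b k U) (μ b k) latMove latN (bondBall d (W.ρw (k + 1)) : Set (Fld d R)) w
        (W.ϱc k) (m * ∑ f ∈ S k b, T.envVar (4 * cδ / r) (fun i => ψ * α i) f k))
    (hDμ : ∀ b k, ∀ᵐ z ∂μ b k, z ∈ (bondBall d (W.σ k) : Set (Fld d R)))
    (hdom : ∀ k, k + 1 ≤ B.K → Real.exp 3 * (1 + 4 * (2 * W.σ k) / W.ϱc k) ≤ α k)
    (hinv : ∀ b k' k, GaugeInvariant (rel b k' k) (Fn b k' k))
    (hdefw : ∀ b k' k, defect b k' k ≤ w)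
    (hrate : ∀ (b : B.Birth) (k' k : ℕ), B.birthScale b ≤ k' → k' ≤ k → k ≤ B.K →
      defect b k' k ≤ cδ * ψ ^ (k - k'))
    (hlin : ∀ (b : B.Birth) (k' k : ℕ), B.birthScale b ≤ k' → k' ≤ k → k ≤ B.K →
      RanBelow (budgetGate T s m S (4 * cδ / r) (fun i => ψ * α i)) k → ∀ ε > 0,
      ∃ U₀ ∈ (bondBall d (W.ρw k) : Set (Fld d R)), ∃ U₁ : Fld d R,
        RelGauge (rel b k' k) latMove latN U₀ U₁ (defect b k' k) ∧
        T.lin b k' k ≤ ‖Fn b k' k U₁ - Fn b k' k U₀‖ + ε) :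
    T.TransportsFromVar (4 * cδ / r) (fun i => ψ * α i) (budgetGate T s m S (4 * cδ / r) (fun i => ψ * α i)) :=
  DressedRoot.transportLeaf_of_centredExponent (𝒦 := fun _ _ k => (bondBall d (W.ρw k) : Set (Fld d R)))
    (D := fun _ k => (bondBall d (W.σ k) : Set (Fld d R))) (θ := fun _ k => 2 * W.σ k) (ϱ := fun _ _ k => W.ϱc k)
    hα hr W.w_pos hsl hFn h𝒢 (hD_of_schedule W) (hϱ_of_schedule W) hB hE hP hDμ (hN1_of_schedule W) (hN2_of_schedule W)
    (hdiam_of_schedule W) (hθ_of_schedule W) (fun _ _ k _ _ hk => hdom k hk) hinv hdefw hrate hlin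

/-- **THE ASSEMBLED `hP` UNDER A WINDOW SCHEDULE** [bookkeeping]: `T4TrajectoryDensityDressed.pertSlice_under_history` with
windows, fluctuation domains, chart radii, margin radii and slice radii read off the schedule (`𝒦 b k′ k := bondBall d (ρw k)`,
`D b k := bondBall d (σ k)`, `ϱ b k′ k := ϱc k`, `ϱ₁ b k := ϱ₁ k`, `rs f k″ k := sliceR W k″ k`) — its binders `hrs_birth`,
`hrs_step`, `hrs_dec`, `hmargin`, `hN1`, `hN1x`, `hN2cx` are DISCHARGED (§2) given the reference fluctuation `z₁ b k ∈ D b k`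
(`hz₁`).  Displayed: (w1) `hsl`, H2 `hFn`, (w2-act) `hB`∕`hE`, the dictionary `hQ`∕`hS`∕`hs1`∕`hAsz_*`, `hDμ`, (I4′) `hpairx`∕
`hδfw`, invariance, measurability, the gate-implies-budget `hbudget`.  Conclusion: the centred perturbation slice of every met
component under the history — the shape of END-F's `hP` with size `s1 b k`. [folklore] -/
theorem pertSlice_under_history_of_schedule {Gate : ℕ → Prop} {Fn : B.Birth → ℕ → ℕ → Fld d R → ℂ}
    {rel : B.Birth → ℕ → ℕ → Fld d R → Fld d R → Prop}
    {ref : B.Birth → ℕ → Fld d R → Fld d R} {base : B.Birth → ℕ → Fld d R → ℝ}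
    {𝒜 𝒬 : B.Birth → ℕ → Fld d R → Fld d R → ℂ} {q : B.Birth → ℕ → Fld d R → ℂ}
    {μ : B.Birth → ℕ → Measure (Fld d R)} {z₀ z₁ : B.Birth → ℕ → Fld d R}
    {s s1 : B.Birth → ℕ → ℝ} {Asz : B.Birth → ℕ → ℕ → ℝ}
    {S : ℕ → B.Birth → Finset (B.Birth × ℕ)} {c : B.Birth → ℕ → ℂ} {δf : B.Birth → ℕ → B.Birth × ℕ → ℝ}
    (hsl : ∀ (b : B.Birth) (k' : ℕ), B.birthScale b ≤ k' → k' ≤ B.K → RanBelow Gate k' →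
      BirthSlice (Fn b k' k') latMove latN (bondBall d (W.ρw k') : Set (Fld d R)) w r (T.gen b k'))
    (hFn : ∀ (b : B.Birth) (k' k : ℕ), B.birthScale b ≤ k' → k' ≤ k → k + 1 ≤ B.K → RanBelow Gate (k + 1) →
      ∀ U, Fn b k' (k + 1) U =
        wOp (expWeight (base b k) (𝒜 b k + 𝒬 b k)) (μ b k) (z₀ b k) U (fun z => Fn b k' k (U + z)))
    (hB : ∀ (b : B.Birth) (k' k : ℕ), B.birthScale b ≤ k' → k' ≤ k → k + 1 ≤ B.K → RanBelow Gate (k + 1) →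
      RealBaseAt (ref b k) (base b k) (𝒜 b k) (μ b k) (bondBall d (W.ρw (k + 1)) : Set (Fld d R)))
    (hE : ∀ (b : B.Birth) (k' k : ℕ), B.birthScale b ≤ k' → k' ≤ k → k + 1 ≤ B.K → RanBelow Gate (k + 1) →
      ExponentSliceAt (ref b k) (𝒜 b k) (μ b k) latMove latN (bondBall d (W.ρw (k + 1)) : Set (Fld d R)) w (W.ϱc k)
        (s b k))
    (hQ : ∀ b k, (fun U z => 𝒬 b k U z - q b k U) =
      fun U z => c b k * ∑ p ∈ S k b, (Fn p.1 p.2 k (U + z) - Fn p.1 p.2 k (U + z₁ b k)))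
    (hS : ∀ k b, ∀ p ∈ S k b, B.birthScale p.1 ≤ p.2 ∧ p.2 ≤ k)
    (hs1 : ∀ b k, s1 b k = ‖c b k‖ * ∑ p ∈ S k b, 4 * Asz p.1 p.2 k / W.sliceR p.2 k * δf b k p)
    (hAsz_birth : ∀ f k'', Asz f k'' k'' = T.gen f k'')
    (hAsz_step : ∀ f k'' k, B.birthScale f ≤ k'' → k'' ≤ k →
      Asz f k'' (k + 1) = Real.exp (3 * (s f k + s1 f k)) * Asz f k'' k)
    (hDμ : ∀ b k, ∀ᵐ z ∂μ b k, z ∈ (bondBall d (W.σ k) : Set (Fld d R)))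
    (hz₁ : ∀ b k, z₁ b k ∈ (bondBall d (W.σ k) : Set (Fld d R)))
    (hpairx : ∀ (b : B.Birth) (k' k : ℕ), B.birthScale b ≤ k' → k' ≤ k →
      ∀ p ∈ S k b, ∀ U₀ ∈ (bondBall d (W.ρw (k + 1)) : Set (Fld d R)), ∀ pd : NDir d R, 0 < latN pd → latN pd ≤ w →
        ∀ᵐ z ∂μ b k, ∀ t ∈ tube (W.ϱ₁ k / latN pd),
          RelGauge (rel p.1 p.2 k) latMove latN (latMove U₀ pd t + z₁ b k) (latMove U₀ pd t + z) (δf b k p))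
    (hδfw : ∀ b k, ∀ p ∈ S k b, δf b k p ≤ w)
    (hinv : ∀ b k' k, GaugeInvariant (rel b k' k) (Fn b k' k))
    (hmeas : ∀ (b f : B.Birth) (k'' k : ℕ) (U : Fld d R), AEStronglyMeasurable (fun z => Fn f k'' k (U + z)) (μ b k))
    (hbudget : ∀ k, k < B.K → Gate k → ∀ b : B.Birth, B.birthScale b ≤ k → s b k + s1 b k ≤ 1) :
    ∀ (b : B.Birth) (k' k : ℕ), B.birthScale b ≤ k' → k' ≤ k → k + 1 ≤ B.K → RanBelow Gate (k + 1) →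
      PertSlice (fun U z => 𝒬 b k U z - q b k U) (μ b k) latMove latN (bondBall d (W.ρw (k + 1)) : Set (Fld d R)) w
        (W.ϱc k) (s1 b k) :=
  pertSlice_under_history (𝒦 := fun _ _ k => (bondBall d (W.ρw k) : Set (Fld d R)))
    (D := fun _ k => (bondBall d (W.σ k) : Set (Fld d R))) (ϱ := fun _ _ k => W.ϱc k) (ϱ₁ := fun _ k => W.ϱ₁ k)
    (rs := fun _ k'' k => W.sliceR k'' k)
    hsl hFn hB hE hQ hS hs1 hAsz_birth (hrs_birth_of_schedule W) hAsz_step (hrs_step_of_schedule W)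
    (hrs_dec_of_schedule W) (hmargin_of_schedule W S) hDμ (hN1_of_schedule W) (hN1x_of_schedule W S)
    (hN2cx_of_schedule W S hz₁) hpairx hδfw hinv hmeas hbudget

end Composition

/-! ## §4 Non-vacuity and the located cost -/

namespace WindowSchedule

/-- **A SCHEDULE EXISTS for every birth radius `r > 0`, chart window `w > 0` and birth window `ρ₀`** [decided toy]: fluctuation
radius `w/2`, chart radii `r·2^{−(k+1)}/2`, margins `r·2^{−(k+1)}`, windows `ρw k = ρ₀ − (2w + r)·k` (linear consumption). [folklore] -/
def geometric (r w ρ₀ : ℝ) (hr : 0 < r) (hw : 0 < w) : WindowSchedule r w where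
  ρw k := ρ₀ - (2 * w + r) * k
  σ _ := w / 2
  ϱc k := r / 2 ^ (k + 1) / 2
  ϱ₁ k := r / 2 ^ (k + 1)
  hσ _ := by positivity
  hσw _ := by linarith
  hϱc _ := by positivity
  hϱc₁ k := half_lt_self (by positivity)
  hϱ₁r k := div_le_self hr.le (one_le_pow₀ (by norm_num))
  hϱ₁c k := le_of_eq (by rw [pow_succ]; ring)
  hgap k := by
    have h : r / 2 ^ (k + 1) ≤ r := div_le_self hr.le (one_le_pow₀ (by norm_num))
    push_cast
    linarith

/-- [decided toy] The windows of the geometric schedule are inhabited at every step `k ≤ K` as soon as the birth window allows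
`(2w + r)·K ≤ ρ₀` — the linear cost of `window_budget` displayed on the witness. [folklore] -/
theorem geometric_window_nonneg {r w ρ₀ : ℝ} (hr : 0 < r) (hw : 0 < w) {K k : ℕ} (hk : k ≤ K)
    (hρ₀ : (2 * w + r) * K ≤ ρ₀) : 0 ≤ (geometric r w ρ₀ hr hw).ρw k := by
  have hkK : (k : ℝ) ≤ K := by exact_mod_cast hk
  show 0 ≤ ρ₀ - (2 * w + r) * k
  nlinarith

/-- [decided toy] Hence the zero background lies in every window of the geometric schedule up to step `K`: the discharged
binders of §2 are inhabited NON-vacuously (windows, fluctuation domains and tubes are proper nonempty sets). [folklore] -/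
theorem geometric_zero_mem_window {R : Type*} [NormedRing R] {d : ℕ} {r w ρ₀ : ℝ} (hr : 0 < r) (hw : 0 < w) {K k : ℕ}
    (hk : k ≤ K) (hρ₀ : (2 * w + r) * K ≤ ρ₀) :
    (0 : Fld d R) ∈ (bondBall d ((geometric r w ρ₀ hr hw).ρw k) : Set (Fld d R)) :=
  fun x ν => by simpa using geometric_window_nonneg hr hw hk hρ₀

end WindowSchedule

end Summit.QuantumFields.BalabanUV.T4Continuum.NE1p.DressedWindowSchedule

end
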